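import Literature.MathematicalPhysics.KineticTheory.CollisionTubeFirstContact
import Literature.Analysis.FluidPDE.HardSphereBilliard
import Literature.MathematicalPhysics.KineticTheory.HardSphereEuler
import Mathlib.Analysis.InnerProductSpace.Calculus
import Mathlib.Analysis.SpecialFunctions.Sqrt
import Mathlib.MeasureTheory.Integral.IntervalIntegral.FundThmCalculus
import HarnessLib

/-!
# Crux `RateFloor` (stmt-AtomisticToContinuum-13080), line `last-flight-poissonization`, stub T (`stub_tubeTransport`):
# free-flight invariance of the predicted contact datum, the backward exit time, the shell-passage bound

Def-free kinematic layer of the ONE-SIDED TUBE TRANSPORT identity `R ≥ W − KO` (skeleton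
`Cruxes/RateFloor/Lines/last_flight_poissonization.lean`, stub T).  Only the tree's static collision tube (`flightTime`,
`impactNormal`, `strictTube` of `Literature/…/CollisionTubeGeometry.lean`, `CollisionTubeFirstContact.lean`) and elementary
analysis appear, so that the skeleton's `backTime`, `episodeWeight`, `Episode`, `Wf`, `Rf`, `KOf` reduce to them term by term:
* §1 TRANSLATION ALONG THE FLIGHT `u ↦ q + u w`: the predicted contact time `u + ε t_h(ε⁻¹ q_u)` and impact normal are
  constant (`flightTime_add_smul`, `impactNormal_add_smul`, scaled `mul_flightTime_inv_smul_add_smul`,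
  `impactNormal_inv_smul_add_smul`; the discriminant is a flight invariant, `disc_add_smul`).  The skeleton's
  `backTime N q w` is `−(2R) t_h((2R)⁻¹ q)` (`neg_mul_flightTime_inv_smul_eq` = `flightTime_scale` at `ε := 2R`).
* §2 AT CONTACT (`‖q‖ = ε`, `⟪q, w⟫ ≤ 0`): flight time `0`, normal `ε⁻¹ q` — the episode weight at a realised incoming
  contact IS the crux's datum (`mul_flightTime_inv_smul_of_norm_eq`, `impactNormal_inv_smul_of_norm_eq`).
* §3 `‖n_h‖ = 1` WITHOUT the tube hypothesis (`norm_impactNormal_eq_one`), the smaller root is negative from inside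
  (`flightTime_neg_of_norm_lt_one`) with the flight inside in between (`norm_add_smul_lt_one_of_flightTime_lt`); read at
  radius `ρ = 2R` these are the facts about the skeleton's `backTime` in its closed form (§3b: `backExit_add_smul`,
  `norm_sub_backExit_smul`, `backExit_pos`, `norm_sub_smul_lt_of_lt_backExit`); §3c: AIMED pairs
  (`1 < ‖Q‖ ∧ ⟪Q, w⟫ < 0 ∧ ‖w‖²(‖Q‖² − 1) < ⟪Q, w⟫²`, the skeleton's `Aimed`) stay aimed for all `t < t_h` (`aimed_add_smul`).
* §4 the inward radial speed `−⟪q_u, w⟫/‖q_u‖` integrates to the drop of `‖q_u‖` (`integral_inner_div_norm`), so `W`'s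
  weight `max(−⟪q_u, w⟫, 0)/(R‖q_u‖)` integrates to `≤ 1` over an approaching stretch from inside `2R` staying outside `R`
  (`integral_radialRate_le_one`): a complete shell passage weighs at most one episode weight.
Registered helper stubs (closed signatures on `V3`): `stub_flightDatumInvariance`, `stub_shellPassageLeOne`.
Elementary; CIP 1994 §2.2 / App. 4.A (collision cylinder), GST 2013 §4.3.
-/

noncomputable section
noncomputable section

open MeasureTheory Set intervalIntegral
open scoped InnerProductSpace
open Literature.Analysis.FluidPDE Literature.MathematicalPhysics.KineticTheory

namespace Summit.AtomisticToContinuum.HydrodynamicLimit.Theorems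

namespace RateFloorTubeFlightInvariance

variable {E : Type*} [NormedAddCommGroup E] [InnerProductSpace ℝ E]

/-! ## §1 Translation along the flight (`inner_add_smul_self`, `norm_add_smul_sq` are `HardSphereBilliard`'s,
`inv_smul_add_smul` is `CollisionTubeFirstContact`'s) -/

/-- **The discriminant of the contact quadratic is a flight invariant** (any radius `ρ`):
`⟪q', w⟫² − ‖w‖²(‖q'‖² − ρ²)` takes the same value at `q' = q + t w` as at `q`. [folklore] -/
theorem disc_add_smul (q w : E) (t ρ : ℝ) :
    ⟪q + t • w, w⟫_ℝ ^ 2 - ‖w‖ ^ 2 * (‖q + t • w‖ ^ 2 - ρ) =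
      ⟪q, w⟫_ℝ ^ 2 - ‖w‖ ^ 2 * (‖q‖ ^ 2 - ρ) := by
  rw [inner_add_smul_self, norm_add_smul_sq]
  ring

/-- **Translation of the flight time**: `t_h(q + t w) = t_h(q) − t` for `w ≠ 0` (the predicted contact
time `u + t_h(q_u)` is constant along the free flight `q_u = q + u w`). [cite: CIPDiluteGases1994, §2.2] -/
theorem flightTime_add_smul {w : E} (hw : w ≠ 0) (q : E) (t : ℝ) :
    flightTime w (q + t • w) = flightTime w q - t := by
  have ha : ‖w‖ ^ 2 ≠ 0 := pow_ne_zero 2 (norm_ne_zero_iff.2 hw)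
  unfold flightTime
  rw [disc_add_smul q w t 1, inner_add_smul_self]
  field_simp
  ring

/-- **Translation invariance of the impact normal**: `n_h(q + t w) = n_h(q)` for `w ≠ 0`. [cite: CIPDiluteGases1994, §2.2] -/
theorem impactNormal_add_smul {w : E} (hw : w ≠ 0) (q : E) (t : ℝ) :
    impactNormal w (q + t • w) = impactNormal w q := by
  unfold impactNormal
  rw [flightTime_add_smul hw, sub_smul]
  abel

/-- Rescaled norm: `‖ρ⁻¹ q‖ = ρ⁻¹ ‖q‖` for `ρ > 0`. [folklore] -/
theorem norm_inv_smul_eq {ρ : ℝ} (hρ : 0 < ρ) (q : E) : ‖ρ⁻¹ • q‖ = ρ⁻¹ * ‖q‖ := by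
  rw [norm_smul, Real.norm_eq_abs, abs_of_pos (inv_pos.2 hρ)]

/-- **Scaled translation of the flight time** (diameter `ε > 0`): the predicted contact time
`u + ε t_h(ε⁻¹ q_u)` is constant along `q_u = q + u w`. [folklore] -/
theorem mul_flightTime_inv_smul_add_smul {ε : ℝ} (hε : 0 < ε) {w : E} (hw : w ≠ 0) (q : E) (u : ℝ) :
    ε * flightTime w (ε⁻¹ • (q + u • w)) = ε * flightTime w (ε⁻¹ • q) - u := by
  rw [inv_smul_add_smul, flightTime_add_smul hw, mul_sub, mul_inv_cancel_left₀ hε.ne']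

/-- **Scaled translation invariance of the impact normal.** [folklore] -/
theorem impactNormal_inv_smul_add_smul (ε : ℝ) {w : E} (hw : w ≠ 0) (q : E) (u : ℝ) :
    impactNormal w (ε⁻¹ • (q + u • w)) = impactNormal w (ε⁻¹ • q) := by
  rw [inv_smul_add_smul, impactNormal_add_smul hw]

/-- **The backward exit time is a scaled flight time**: the positive root of `‖q − t w‖ = ρ`, in the closed
form `(⟪q, w⟫ + √(⟪q, w⟫² − ‖w‖²(‖q‖² − ρ²)))/‖w‖²` used by the skeleton's `backTime` (with `ρ = 2 R_N(w)`), equals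
`−ρ · t_h(ρ⁻¹ q)` (`flightTime_scale`). [folklore] -/
theorem neg_mul_flightTime_inv_smul_eq {ρ : ℝ} (hρ : 0 < ρ) (q w : E) :
    (⟪q, w⟫_ℝ + Real.sqrt (⟪q, w⟫_ℝ ^ 2 - ‖w‖ ^ 2 * (‖q‖ ^ 2 - ρ ^ 2))) / ‖w‖ ^ 2 =
      -(ρ * flightTime w (ρ⁻¹ • q)) := by
  rw [← flightTime_scale hρ q w]
  ring

/-! ## §2 At contact -/

/-- **At contact the flight time vanishes**: `‖q‖ = 1`, `⟪q, w⟫ ≤ 0` give `t_h = 0` (also for `w = 0`). [folklore] -/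
theorem flightTime_of_norm_eq_one {q w : E} (hq : ‖q‖ = 1) (hqw : ⟪q, w⟫_ℝ ≤ 0) : flightTime w q = 0 := by
  unfold flightTime
  rw [hq, one_pow, sub_self, mul_zero, sub_zero, Real.sqrt_sq_eq_abs, abs_of_nonpos hqw, sub_neg_eq_add,
    neg_add_cancel, zero_div]

/-- **At contact the impact normal is the separation**: `‖q‖ = 1`, `⟪q, w⟫ ≤ 0` give `n_h = q`. [folklore] -/
theorem impactNormal_of_norm_eq_one {q w : E} (hq : ‖q‖ = 1) (hqw : ⟪q, w⟫_ℝ ≤ 0) : impactNormal w q = q := by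
  rw [impactNormal, flightTime_of_norm_eq_one hq hqw, zero_smul, add_zero]

/-- At scale `ε > 0`: `‖q‖ = ε` gives `‖ε⁻¹ q‖ = 1`, and `⟪q, w⟫ ≤ 0` gives `⟪ε⁻¹ q, w⟫ ≤ 0`. [folklore] -/
theorem norm_inv_smul_eq_one_and {ε : ℝ} (hε : 0 < ε) {q w : E} (hq : ‖q‖ = ε) (hqw : ⟪q, w⟫_ℝ ≤ 0) :
    ‖ε⁻¹ • q‖ = 1 ∧ ⟪ε⁻¹ • q, w⟫_ℝ ≤ 0 := by
  refine ⟨by rw [norm_inv_smul_eq hε, hq, inv_mul_cancel₀ hε.ne'], ?_⟩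
  rw [real_inner_smul_left]
  exact mul_nonpos_of_nonneg_of_nonpos (inv_pos.2 hε).le hqw

/-- Scaled contact, flight time: `‖q‖ = ε > 0`, `⟪q, w⟫ ≤ 0` give `ε t_h(ε⁻¹ q) = 0`. [folklore] -/
theorem mul_flightTime_inv_smul_of_norm_eq {ε : ℝ} (hε : 0 < ε) {q w : E} (hq : ‖q‖ = ε) (hqw : ⟪q, w⟫_ℝ ≤ 0) :
    ε * flightTime w (ε⁻¹ • q) = 0 := by
  obtain ⟨h1, h2⟩ := norm_inv_smul_eq_one_and hε hq hqw
  rw [flightTime_of_norm_eq_one h1 h2, mul_zero]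

/-- Scaled contact, normal: `‖q‖ = ε > 0`, `⟪q, w⟫ ≤ 0` give `n_h(ε⁻¹ q) = ε⁻¹ q`. [folklore] -/
theorem impactNormal_inv_smul_of_norm_eq {ε : ℝ} (hε : 0 < ε) {q w : E} (hq : ‖q‖ = ε) (hqw : ⟪q, w⟫_ℝ ≤ 0) :
    impactNormal w (ε⁻¹ • q) = ε⁻¹ • q := by
  obtain ⟨h1, h2⟩ := norm_inv_smul_eq_one_and hε hq hqw
  exact impactNormal_of_norm_eq_one h1 h2

/-! ## §3 The root property without the tube hypothesis; the flight from inside the ball -/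

/-- From inside the closed unit ball the discriminant is nonnegative. [folklore] -/
theorem disc_nonneg_of_norm_le_one {q : E} (hq : ‖q‖ ≤ 1) (w : E) :
    0 ≤ ⟪q, w⟫_ℝ ^ 2 - ‖w‖ ^ 2 * (‖q‖ ^ 2 - 1) := by
  have h : ‖q‖ ^ 2 ≤ 1 := by simpa only [one_pow] using pow_le_pow_left₀ (norm_nonneg q) hq 2
  nlinarith [sq_nonneg ⟪q, w⟫_ℝ, sq_nonneg ‖w‖]

/-- **The flight time is a root of the contact quadratic** whenever the discriminant is nonnegative and `w ≠ 0`: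
`‖w‖² t_h² + 2 ⟪q, w⟫ t_h + (‖q‖² − 1) = 0`. [cite: CIPDiluteGases1994, §2.2] -/
theorem flightTime_root {q w : E} (hw : w ≠ 0) (hD : 0 ≤ ⟪q, w⟫_ℝ ^ 2 - ‖w‖ ^ 2 * (‖q‖ ^ 2 - 1)) :
    ‖w‖ ^ 2 * flightTime w q ^ 2 + 2 * ⟪q, w⟫_ℝ * flightTime w q + (‖q‖ ^ 2 - 1) = 0 := by
  have ha : ‖w‖ ^ 2 ≠ 0 := pow_ne_zero 2 (norm_ne_zero_iff.2 hw)
  set s := Real.sqrt (⟪q, w⟫_ℝ ^ 2 - ‖w‖ ^ 2 * (‖q‖ ^ 2 - 1)) with hs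
  have hs2 : s ^ 2 = ⟪q, w⟫_ℝ ^ 2 - ‖w‖ ^ 2 * (‖q‖ ^ 2 - 1) := Real.sq_sqrt hD
  have hth : flightTime w q = (-⟪q, w⟫_ℝ - s) / ‖w‖ ^ 2 := rfl
  rw [hth]
  field_simp
  linear_combination hs2

/-- **`‖n_h‖ = 1` without the tube hypothesis**: the predicted impact normal is a unit vector as soon as the
discriminant is nonnegative and `w ≠ 0` (inside OR outside the ball). [cite: CIPDiluteGases1994, §2.2] -/
theorem norm_impactNormal_eq_one {q w : E} (hw : w ≠ 0) (hD : 0 ≤ ⟪q, w⟫_ℝ ^ 2 - ‖w‖ ^ 2 * (‖q‖ ^ 2 - 1)) :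
    ‖impactNormal w q‖ = 1 := by
  have hroot := flightTime_root hw hD
  have hn2 : ‖impactNormal w q‖ ^ 2 = 1 := by
    rw [impactNormal, norm_add_smul_sq]
    linear_combination hroot
  exact (sq_eq_sq₀ (norm_nonneg (impactNormal w q)) zero_le_one).1 (by rw [hn2, one_pow])

/-- **From inside the open ball the smaller root is negative**: `‖q‖ < 1`, `w ≠ 0` give `t_h(q) < 0` (so the
backward exit time `−t_h > 0`). [folklore] -/
theorem flightTime_neg_of_norm_lt_one {q w : E} (hw : w ≠ 0) (hq : ‖q‖ < 1) : flightTime w q < 0 := by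
  have ha : 0 < ‖w‖ ^ 2 := by positivity
  have hc : ‖q‖ ^ 2 < 1 := by simpa only [one_pow] using pow_lt_pow_left₀ hq (norm_nonneg q) two_ne_zero
  set D := ⟪q, w⟫_ℝ ^ 2 - ‖w‖ ^ 2 * (‖q‖ ^ 2 - 1) with hD
  have hDb : ⟪q, w⟫_ℝ ^ 2 < D := by rw [hD]; nlinarith
  have hsb : -⟪q, w⟫_ℝ < Real.sqrt D := lt_of_pow_lt_pow_left₀ 2 (Real.sqrt_nonneg D)
    (by rwa [neg_sq, Real.sq_sqrt (by nlinarith [sq_nonneg ⟪q, w⟫_ℝ])])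
  unfold flightTime
  exact div_neg_of_neg_of_pos (by linarith) ha

/-- **Between the backward exit and now the flight is inside the ball**: `‖q‖ < 1`, `w ≠ 0`, `t_h(q) < s ≤ 0` give
`‖q + s w‖ < 1` (the contact quadratic is negative strictly between its roots `t_h < 0 < t_+`). [folklore] -/
theorem norm_add_smul_lt_one_of_flightTime_lt {q w : E} (hw : w ≠ 0) (hq : ‖q‖ < 1) {s : ℝ}
    (hs : flightTime w q < s) (hs0 : s ≤ 0) : ‖q + s • w‖ < 1 := by
  have ha : 0 < ‖w‖ ^ 2 := by positivity
  have hc : ‖q‖ ^ 2 < 1 := by simpa only [one_pow] using pow_lt_pow_left₀ hq (norm_nonneg q) two_ne_zero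
  set D := ⟪q, w⟫_ℝ ^ 2 - ‖w‖ ^ 2 * (‖q‖ ^ 2 - 1) with hD
  have hD0 : 0 ≤ D := by rw [hD]; nlinarith [sq_nonneg ⟪q, w⟫_ℝ]
  set r := Real.sqrt D with hr
  have hr2 : r ^ 2 = D := Real.sq_sqrt hD0
  have hDb : ⟪q, w⟫_ℝ ^ 2 < D := by rw [hD]; nlinarith
  have hrb : ⟪q, w⟫_ℝ < r := lt_of_pow_lt_pow_left₀ 2 (Real.sqrt_nonneg D) (by rwa [hr2])
  have hth : flightTime w q = (-⟪q, w⟫_ℝ - r) / ‖w‖ ^ 2 := rfl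
  -- factorisation of the contact quadratic: `‖q + s w‖² − 1 = (s − t_h) (‖w‖² s + ⟪q, w⟫ − r)`
  have hfac : ‖q + s • w‖ ^ 2 - 1 = (s - flightTime w q) * (‖w‖ ^ 2 * s + ⟪q, w⟫_ℝ - r) := by
    rw [norm_add_smul_sq, hth]
    field_simp
    linear_combination hr2 + hD
  have h1 : 0 < s - flightTime w q := sub_pos.2 hs
  have h2 : ‖w‖ ^ 2 * s + ⟪q, w⟫_ℝ - r < 0 := by nlinarith
  have hlt : ‖q + s • w‖ ^ 2 < 1 := by nlinarith [mul_neg_of_pos_of_neg h1 h2]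
  exact lt_of_pow_lt_pow_left₀ 2 zero_le_one (by rwa [one_pow])

/-! ## §3b The backward exit time at radius `ρ`: closed form `T = (⟪q, w⟫ + √(⟪q, w⟫² − ‖w‖²(‖q‖² − ρ²)))/‖w‖²`
(hypothesis `hT`; the skeleton's `backTime N q w` verbatim for `ρ := 2 * tubeRad N w`) -/

/-- **Translation of the backward exit time**: `T(q + u w) = T(q) + u` (`ρ > 0`, `w ≠ 0`; the shell-start time
`s − T(q_s)` of an episode is constant along its free flight). [folklore] -/
theorem backExit_add_smul {ρ : ℝ} (hρ : 0 < ρ) {w : E} (hw : w ≠ 0) (q : E) (u : ℝ) :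
    (⟪q + u • w, w⟫_ℝ + Real.sqrt (⟪q + u • w, w⟫_ℝ ^ 2 - ‖w‖ ^ 2 * (‖q + u • w‖ ^ 2 - ρ ^ 2))) / ‖w‖ ^ 2 =
      (⟪q, w⟫_ℝ + Real.sqrt (⟪q, w⟫_ℝ ^ 2 - ‖w‖ ^ 2 * (‖q‖ ^ 2 - ρ ^ 2))) / ‖w‖ ^ 2 + u := by
  rw [neg_mul_flightTime_inv_smul_eq hρ, neg_mul_flightTime_inv_smul_eq hρ,
    mul_flightTime_inv_smul_add_smul hρ hw]
  ring

/-- **The backward exit point is ON the sphere of radius `ρ`**: `‖q − T w‖ = ρ` for `‖q‖ ≤ ρ`, `w ≠ 0`. [folklore] -/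
theorem norm_sub_backExit_smul {ρ : ℝ} (hρ : 0 < ρ) {q w : E} (hw : w ≠ 0) (hq : ‖q‖ ≤ ρ) {T : ℝ}
    (hT : T = (⟪q, w⟫_ℝ + Real.sqrt (⟪q, w⟫_ℝ ^ 2 - ‖w‖ ^ 2 * (‖q‖ ^ 2 - ρ ^ 2))) / ‖w‖ ^ 2) :
    ‖q - T • w‖ = ρ := by
  have h1 : ‖ρ⁻¹ • q‖ ≤ 1 := by rwa [norm_inv_smul_eq hρ, inv_mul_le_iff₀ hρ, mul_one]
  rw [hT, neg_mul_flightTime_inv_smul_eq hρ, neg_smul, sub_neg_eq_add, add_mul_flightTime_smul hρ, norm_smul,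
    Real.norm_eq_abs, abs_of_pos hρ, norm_impactNormal_eq_one hw (disc_nonneg_of_norm_le_one h1 w), mul_one]

/-- **The backward exit time is positive** from strictly inside: `0 < T` for `‖q‖ < ρ`, `w ≠ 0`. [folklore] -/
theorem backExit_pos {ρ : ℝ} (hρ : 0 < ρ) {q w : E} (hw : w ≠ 0) (hq : ‖q‖ < ρ) {T : ℝ}
    (hT : T = (⟪q, w⟫_ℝ + Real.sqrt (⟪q, w⟫_ℝ ^ 2 - ‖w‖ ^ 2 * (‖q‖ ^ 2 - ρ ^ 2))) / ‖w‖ ^ 2) : 0 < T := by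
  have h1 : ‖ρ⁻¹ • q‖ < 1 := by rwa [norm_inv_smul_eq hρ, inv_mul_lt_iff₀ hρ, mul_one]
  rw [hT, neg_mul_flightTime_inv_smul_eq hρ, neg_pos]
  exact mul_neg_of_pos_of_neg hρ (flightTime_neg_of_norm_lt_one hw h1)

/-- **Between the exit and now the flight is strictly inside radius `ρ`**: `‖q − t w‖ < ρ` for `0 ≤ t < T`
(`‖q‖ < ρ`, `w ≠ 0`). [folklore] -/
theorem norm_sub_smul_lt_of_lt_backExit {ρ : ℝ} (hρ : 0 < ρ) {q w : E} (hw : w ≠ 0) (hq : ‖q‖ < ρ) {T : ℝ}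
    (hT : T = (⟪q, w⟫_ℝ + Real.sqrt (⟪q, w⟫_ℝ ^ 2 - ‖w‖ ^ 2 * (‖q‖ ^ 2 - ρ ^ 2))) / ‖w‖ ^ 2)
    {t : ℝ} (ht0 : 0 ≤ t) (ht : t < T) : ‖q - t • w‖ < ρ := by
  have h1 : ‖ρ⁻¹ • q‖ < 1 := by rwa [norm_inv_smul_eq hρ, inv_mul_lt_iff₀ hρ, mul_one]
  rw [hT, neg_mul_flightTime_inv_smul_eq hρ] at ht
  -- `s := −t/ρ` lies in `(t_h(ρ⁻¹ q), 0]`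
  have hs : flightTime w (ρ⁻¹ • q) < -(ρ⁻¹ * t) := by
    rw [neg_mul_eq_mul_neg, lt_inv_mul_iff₀ hρ]
    linarith
  have hs0 : -(ρ⁻¹ * t) ≤ 0 := by
    rw [neg_nonpos]
    exact mul_nonneg (inv_pos.2 hρ).le ht0
  have key := norm_add_smul_lt_one_of_flightTime_lt hw h1 hs hs0
  have e : ρ⁻¹ • q + -(ρ⁻¹ * t) • w = ρ⁻¹ • (q - t • w) := by
    rw [smul_sub, smul_smul, neg_smul, sub_eq_add_neg]
  rw [e, norm_inv_smul_eq hρ, inv_mul_lt_iff₀ hρ, mul_one] at key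
  exact key

/-! ## §3c Aimed pairs (`1 < ‖Q‖ ∧ ⟪Q, w⟫ < 0 ∧ ‖w‖²(‖Q‖² − 1) < ⟪Q, w⟫²`) stay aimed until the predicted contact -/

/-- **An aimed pair is in the strict tube of its own flight time.** [folklore] -/
theorem mem_strictTube_flightTime {Q w : E} (h1 : 1 < ‖Q‖) (h2 : ⟪Q, w⟫_ℝ < 0)
    (h3 : ‖w‖ ^ 2 * (‖Q‖ ^ 2 - 1) < ⟪Q, w⟫_ℝ ^ 2) : Q ∈ strictTube (flightTime w Q) w :=
  ⟨h1, h2, h3, le_rfl⟩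

/-- **Aimed pairs stay aimed strictly before the predicted contact** (backwards for all times, forwards up to
`t_h`): for `t < t_h(Q)` the translate `Q + t w` is again apart, approaching, with positive discriminant, and its
flight time is `t_h(Q) − t`. [cite: CIPDiluteGases1994, §2.2] -/
theorem aimed_add_smul {Q w : E} (h1 : 1 < ‖Q‖) (h2 : ⟪Q, w⟫_ℝ < 0)
    (h3 : ‖w‖ ^ 2 * (‖Q‖ ^ 2 - 1) < ⟪Q, w⟫_ℝ ^ 2) {t : ℝ} (ht : t < flightTime w Q) :
    1 < ‖Q + t • w‖ ∧ ⟪Q + t • w, w⟫_ℝ < 0 ∧ ‖w‖ ^ 2 * (‖Q + t • w‖ ^ 2 - 1) < ⟪Q + t • w, w⟫_ℝ ^ 2 := by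
  obtain ⟨_, hn1, hnw, hQ⟩ := strictTube_spec (mem_strictTube_flightTime h1 h2 h3)
  have hτ : 0 < flightTime w Q - t := sub_pos.2 ht
  have e : Q + t • w = impactNormal w Q - (flightTime w Q - t) • w := by
    conv_lhs => rw [hQ]
    rw [sub_smul]
    abel
  have hmem := (sub_smul_mem_strictTube_iff (κ := flightTime w Q - t) hn1 hnw hτ).2 le_rfl
  rw [← e] at hmem
  exact ⟨hmem.1, hmem.2.1, hmem.2.2.1⟩

/-- **Scaled form**: if `ε⁻¹ q` is aimed for `w` and `u < ε t_h(ε⁻¹ q)` (before the predicted contact time at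
diameter `ε > 0`), then `ε⁻¹ (q + u w)` is aimed; in particular the pair is still apart, `ε < ‖q + u w‖`. [folklore] -/
theorem aimed_inv_smul_add_smul {ε : ℝ} (hε : 0 < ε) {q w : E} (h1 : 1 < ‖ε⁻¹ • q‖) (h2 : ⟪ε⁻¹ • q, w⟫_ℝ < 0)
    (h3 : ‖w‖ ^ 2 * (‖ε⁻¹ • q‖ ^ 2 - 1) < ⟪ε⁻¹ • q, w⟫_ℝ ^ 2) {u : ℝ}
    (hu : u < ε * flightTime w (ε⁻¹ • q)) :
    1 < ‖ε⁻¹ • (q + u • w)‖ ∧ ⟪ε⁻¹ • (q + u • w), w⟫_ℝ < 0 ∧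
      ‖w‖ ^ 2 * (‖ε⁻¹ • (q + u • w)‖ ^ 2 - 1) < ⟪ε⁻¹ • (q + u • w), w⟫_ℝ ^ 2 := by
  rw [inv_smul_add_smul]
  refine aimed_add_smul h1 h2 h3 ?_
  rwa [inv_mul_lt_iff₀ hε]

/-- **Before the predicted contact the pair is apart**: `ε < ‖q + u w‖` for `u < ε t_h(ε⁻¹ q)`. [folklore] -/
theorem lt_norm_add_smul_of_lt_mul_flightTime {ε : ℝ} (hε : 0 < ε) {q w : E} (h1 : 1 < ‖ε⁻¹ • q‖)
    (h2 : ⟪ε⁻¹ • q, w⟫_ℝ < 0) (h3 : ‖w‖ ^ 2 * (‖ε⁻¹ • q‖ ^ 2 - 1) < ⟪ε⁻¹ • q, w⟫_ℝ ^ 2) {u : ℝ}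
    (hu : u < ε * flightTime w (ε⁻¹ • q)) : ε < ‖q + u • w‖ := by
  have h := (aimed_inv_smul_add_smul hε h1 h2 h3 hu).1
  rwa [norm_inv_smul_eq hε, lt_inv_mul_iff₀ hε, mul_one] at h

/-- **At the predicted contact the pair touches**: `‖q + (ε t_h) w‖ = ε` for an aimed `ε⁻¹ q`. [folklore] -/
theorem norm_add_mul_flightTime_smul_of_aimed {ε : ℝ} (hε : 0 < ε) {q w : E} (h1 : 1 < ‖ε⁻¹ • q‖)
    (h2 : ⟪ε⁻¹ • q, w⟫_ℝ < 0) (h3 : ‖w‖ ^ 2 * (‖ε⁻¹ • q‖ ^ 2 - 1) < ⟪ε⁻¹ • q, w⟫_ℝ ^ 2) :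
    ‖q + (ε * flightTime w (ε⁻¹ • q)) • w‖ = ε :=
  norm_add_mul_flightTime_smul hε (mem_strictTube_flightTime h1 h2 h3)

/-- The predicted flight time of an aimed pair is positive. [folklore] -/
theorem flightTime_pos_of_aimed {Q w : E} (h1 : 1 < ‖Q‖) (h2 : ⟪Q, w⟫_ℝ < 0)
    (h3 : ‖w‖ ^ 2 * (‖Q‖ ^ 2 - 1) < ⟪Q, w⟫_ℝ ^ 2) : 0 < flightTime w Q :=
  (strictTube_spec (mem_strictTube_flightTime h1 h2 h3)).1

/-! ## §4 Approach monotonicity and the radial fundamental theorem of calculus -/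

/-- **While approaching, the distance decreases**: `s ≤ t` and `⟪q + t w, w⟫ ≤ 0` give `‖q + t w‖ ≤ ‖q + s w‖`. [folklore] -/
theorem norm_add_smul_anti {q w : E} {s t : ℝ} (hst : s ≤ t) (ht : ⟪q + t • w, w⟫_ℝ ≤ 0) :
    ‖q + t • w‖ ≤ ‖q + s • w‖ := by
  have key : ‖q + s • w‖ ^ 2 - ‖q + t • w‖ ^ 2 = (s - t) * (2 * ⟪q + t • w, w⟫_ℝ + (s - t) * ‖w‖ ^ 2) := by
    rw [norm_add_smul_sq, norm_add_smul_sq, inner_add_smul_self]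
    ring
  have h1 : s - t ≤ 0 := sub_nonpos.2 hst
  have h2 : 2 * ⟪q + t • w, w⟫_ℝ + (s - t) * ‖w‖ ^ 2 ≤ 0 := by nlinarith [sq_nonneg ‖w‖]
  have hsq : ‖q + t • w‖ ^ 2 ≤ ‖q + s • w‖ ^ 2 := by nlinarith [mul_nonneg_of_nonpos_of_nonpos h1 h2]
  exact le_of_pow_le_pow_left₀ two_ne_zero (norm_nonneg _) hsq

/-- **The radial speed**: `u ↦ ‖q + u w‖` has derivative `⟪q + u w, w⟫/‖q + u w‖` wherever `q + u w ≠ 0`. [folklore] -/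
theorem hasDerivAt_norm_add_smul (q w : E) {u : ℝ} (h0 : q + u • w ≠ 0) :
    HasDerivAt (fun u : ℝ => ‖q + u • w‖) (⟪q + u • w, w⟫_ℝ / ‖q + u • w‖) u := by
  have hf : HasDerivAt (fun u : ℝ => q + u • w) w u := by
    simpa using ((hasDerivAt_id u).smul_const w).const_add q
  have hsq := hf.norm_sq
  have hne : ‖q + u • w‖ ^ 2 ≠ 0 := pow_ne_zero 2 (norm_ne_zero_iff.2 h0)
  have hsqrt := hsq.sqrt hne
  have hfun : (fun y : ℝ => Real.sqrt (‖q + y • w‖ ^ 2)) = fun y => ‖q + y • w‖ := by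
    funext y
    exact Real.sqrt_sq (norm_nonneg _)
  rw [hfun, Real.sqrt_sq (norm_nonneg _)] at hsqrt
  convert hsqrt using 1
  field_simp

/-- **The radial FTC**: over a stretch `[a, b]` on which the flight does not pass through the origin,
`∫_a^b ⟪q + u w, w⟫/‖q + u w‖ du = ‖q + b w‖ − ‖q + a w‖`. [folklore] -/
theorem integral_inner_div_norm {q w : E} {a b : ℝ} (hab : a ≤ b) (h0 : ∀ u ∈ Icc a b, q + u • w ≠ 0) :
    ∫ u in a..b, ⟪q + u • w, w⟫_ℝ / ‖q + u • w‖ = ‖q + b • w‖ - ‖q + a • w‖ := by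
  have hderiv : ∀ u ∈ uIcc a b, HasDerivAt (fun u : ℝ => ‖q + u • w‖) (⟪q + u • w, w⟫_ℝ / ‖q + u • w‖) u := by
    intro u hu
    rw [uIcc_of_le hab] at hu
    exact hasDerivAt_norm_add_smul q w (h0 u hu)
  have hcont : ContinuousOn (fun u : ℝ => ⟪q + u • w, w⟫_ℝ / ‖q + u • w‖) (uIcc a b) := by
    rw [uIcc_of_le hab]
    refine ContinuousOn.div (by fun_prop) (by fun_prop) fun u hu => norm_ne_zero_iff.2 (h0 u hu)
  exact integral_eq_sub_of_hasDerivAt hderiv (hcont.intervalIntegrable)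

/-- **A shell passage weighs at most one**: over an approaching stretch `[a, b]` (`⟪q_u, w⟫ ≤ 0`) that starts inside
radius `2R` and stays outside radius `R > 0`, the `W`-weight `max(−⟪q_u, w⟫, 0)/(R ‖q_u‖)` of the skeleton integrates to
at most `(‖q_a‖ − ‖q_b‖)/R ≤ 1`. [folklore] -/
theorem integral_radialRate_le_one {q w : E} {a b R : ℝ} (hR : 0 < R) (hab : a ≤ b)
    (happ : ∀ u ∈ Icc a b, ⟪q + u • w, w⟫_ℝ ≤ 0) (hout : ∀ u ∈ Icc a b, R ≤ ‖q + u • w‖)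
    (ha : ‖q + a • w‖ ≤ 2 * R) :
    ∫ u in a..b, max (-⟪q + u • w, w⟫_ℝ) 0 / (R * ‖q + u • w‖) ≤ 1 := by
  have h0 : ∀ u ∈ Icc a b, q + u • w ≠ 0 := fun u hu h => by
    have := hout u hu
    rw [h, norm_zero] at this
    exact absurd this (not_le.2 hR)
  have heq : ∀ u ∈ Icc a b, max (-⟪q + u • w, w⟫_ℝ) 0 / (R * ‖q + u • w‖) =
      -R⁻¹ * (⟪q + u • w, w⟫_ℝ / ‖q + u • w‖) := by
    intro u hu
    rw [max_eq_left (neg_nonneg.2 (happ u hu))]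
    field_simp
  have hcont : ContinuousOn (fun u : ℝ => ⟪q + u • w, w⟫_ℝ / ‖q + u • w‖) (Icc a b) :=
    ContinuousOn.div (by fun_prop) (by fun_prop) fun u hu => norm_ne_zero_iff.2 (h0 u hu)
  calc ∫ u in a..b, max (-⟪q + u • w, w⟫_ℝ) 0 / (R * ‖q + u • w‖)
      = ∫ u in a..b, -R⁻¹ * (⟪q + u • w, w⟫_ℝ / ‖q + u • w‖) :=
        integral_congr fun u hu => heq u (by rwa [uIcc_of_le hab] at hu)
    _ = -R⁻¹ * (‖q + b • w‖ - ‖q + a • w‖) := by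
        rw [intervalIntegral.integral_const_mul, integral_inner_div_norm hab h0]
    _ ≤ 1 := by
        have hb : R ≤ ‖q + b • w‖ := hout b (right_mem_Icc.2 hab)
        rw [neg_mul, inv_mul_eq_div, neg_le, le_div_iff₀ hR]
        linarith

/-! ## Registered helper stubs (closed signatures on `V3`) -/

/-- **Registered helper stub `stub_flightDatumInvariance`** of crux stmt-AtomisticToContinuum-13080 (line
`last-flight-poissonization`, kinematic input of `stub_tubeTransport`): along the free relative flight `q + u w`
(`w ≠ 0`, diameter `ε > 0`) the predicted contact time `u + ε t_h(ε⁻¹ q_u)` and impact normal are constant, and at an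
incoming contact `‖q‖ = ε`, `⟪q, w⟫ ≤ 0` they are `0` and `ε⁻¹ q`. [folklore] -/
theorem stub_flightDatumInvariance : ∀ (ε : ℝ), 0 < ε → ∀ (q w : V3), w ≠ 0 → (∀ u : ℝ, ε * flightTime w (ε⁻¹ • (q + u • w)) = ε * flightTime w (ε⁻¹ • q) - u ∧ impactNormal w (ε⁻¹ • (q + u • w)) = impactNormal w (ε⁻¹ • q)) ∧ (‖q‖ = ε → inner ℝ q w ≤ 0 → ε * flightTime w (ε⁻¹ • q) = 0 ∧ impactNormal w (ε⁻¹ • q) = ε⁻¹ • q) :=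
  fun _ε hε q _w hw => ⟨fun u => ⟨mul_flightTime_inv_smul_add_smul hε hw q u, impactNormal_inv_smul_add_smul _ hw q u⟩,
    fun hq hqw => ⟨mul_flightTime_inv_smul_of_norm_eq hε hq hqw, impactNormal_inv_smul_of_norm_eq hε hq hqw⟩⟩

/-- **Registered helper stub `stub_shellPassageLeOne`** of crux stmt-AtomisticToContinuum-13080 (line
`last-flight-poissonization`, the "complete shell passage weighs exactly one episode weight" input of
`stub_tubeTransport`): over an approaching stretch that starts inside radius `2R` and stays outside radius `R > 0`, the
`W`-weight `max(−⟪q_u, w⟫, 0)/(R ‖q_u‖)` integrates to at most `1`. [folklore] -/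
theorem stub_shellPassageLeOne : ∀ (q w : V3) (a b R : ℝ), 0 < R → a ≤ b → (∀ u ∈ Set.Icc a b, inner ℝ (q + u • w) w ≤ 0) → (∀ u ∈ Set.Icc a b, R ≤ ‖q + u • w‖) → ‖q + a • w‖ ≤ 2 * R → (∫ u in a..b, max (-inner ℝ (q + u • w) w) 0 / (R * ‖q + u • w‖)) ≤ 1 :=
  fun _q _w _a _b _R hR hab happ hout ha => integral_radialRate_le_one hR hab happ hout ha

end RateFloorTubeFlightInvariance

end Summit.AtomisticToContinuum.HydrodynamicLimit.Theorems

end
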